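import Summits.CriticalPhenomena.PercolationContinuityZ3.Theorems.PercNearOneGluingAdditiveGluingBlockGoodTwoRelays
import Summits.CriticalPhenomena.PercolationContinuityZ3.Theorems.PercNearOneGluingAdditiveGluingBlockGoodLeaves
import HarnessLib

/-! # Crux `PercNearOneGluing.AdditiveGluing` (stmt-CriticalPhenomena-4576), stub `stub_goodStep` — the block kernel at
# `A.card ≤ 4`: reduction to its BAD CORE

TTRL deep seat `ttrlatt-v1352-d0` (variant V1352 = the block kernel `stub_blockGoodCardLeThree_sp` with `A.card ≤ 3`
replaced by `A.card ≤ 4`, ANY block `S ≠ ∅`, only the minimiser hypothesis).  Lands `--supports stmt-CriticalPhenomena-4576`;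
no definitions, no named facts.

`BG(S)` denotes the block-goodness inequality of the UN-GLUED graph against the un-glued minimiser `a₀`,
`μ(a₀↔b) + μ(a₀↮b, a₀↔S, S↔b) ≤ μ(S↔b) + Σ_{W∩A=∅} μ(K_S = W)·μ(sel W ↔ b in Wᶜ)`, `K_S = ⋃_{s∈S} C(s)`.

* `blockGood_of_target_mem_block`: `BG(S)` whenever `b ∈ S` (then `μ(S ↔ b) = 1`).
* `blockGood_cardLeFour_of_badCore`: for `A.card ≤ 4`, `BG(S)` holds for EVERY block `S ≠ ∅` as soon as it holds in the
  BAD CORE: `A.card = 4`, `a₀ ≠ b`, `S` disjoint from `A` and every vertex of `S` strictly less reliable than `a₀`.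
  All other cases are landed theorems: `A.card ≤ 3` is the two-relay drift theorem `blockGood_cardLeThree`; `a₀ = b` is
  `blockGood_of_target_min`; `b ∈ S` is the first bullet; a block containing a vertex `v` with `μ(a₀↔b) ≤ μ(v↔b)` (in
  particular a block meeting `A`) is Kozma–Nitzan's Lemma 5 leaf `blockGood_leaf_lemma5`.
* `blockGood_cardLeFour_var1352_of_badCore`: the registered variant V1352 verbatim, from the bad core stated as a closed
  formula (the next variant).  Its point-observer instance `S = {o}` is Kozma–Nitzan goodness of `(G, A, o, b)` with three
  relays besides the target and a bad observer — their Question 7 at `|A ∖ b| = 3`, open in print; so V1352 is not weaker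
  than that question, while the route's residual kernel (`goodStep_of_residualKernel`) only needs the DRIFT sub-case.
[cite: KozmaNitzan2024, §3.2 (Definition p. 12, Lemma 5 p. 13), Question 7 (p. 36), Lemma 3 (pp. 6–7)]
-/

namespace Summit.CriticalPhenomena.PercolationContinuityZ3.Theorems

open MeasureTheory Set
open Literature.Probability.LatticeModels (prodBernoulli)
open Literature.Probability.Percolation (BondConfig openConn openConnIn openGraph openCluster)
open scoped BigOperators

noncomputable section
open Classical

section BlockGoodCardFourReduction

open Literature.Probability.LatticeModels Literature.Probability.Percolation

variable {n : ℕ}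

/-- **Block goodness when the target lies in the block.**  If `b ∈ S` then `μ(S ↔ b) = 1`, which dominates the
left-hand side `μ(a₀↔b) + μ(a₀↮b, …) ≤ μ(a₀↔b) + μ(a₀↮b) = 1`. [cite: KozmaNitzan2024, §3.2 (Definition p. 12)] -/
theorem blockGood_of_target_mem_block (u : Sym2 (Fin n) → unitInterval) (A S : Finset (Fin n)) (b a₀ : Fin n)
    (sel : Finset (Fin n) → Fin n) (hbS : b ∈ S) :
    (prodBernoulli u).real (openConn a₀ b)
        + (prodBernoulli u).real
            ((openConn a₀ b)ᶜ ∩ (⋃ s ∈ S, openConn a₀ s) ∩ (⋃ s ∈ S, openConn s b))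
      ≤ (prodBernoulli u).real (⋃ s ∈ S, openConn s b)
        + ∑ W ∈ (Finset.univ : Finset (Finset (Fin n))).filter (fun W => Disjoint W A),
            (prodBernoulli u).real {ω : BondConfig (Fin n) | ∀ z : Fin n, (z ∈ W ↔ ω ∈ ⋃ s ∈ S, openConn s z)}
              * (prodBernoulli u).real (openConnIn ((W : Set (Fin n))ᶜ) (sel W) b) := by
  set μ := prodBernoulli u with hμ
  have hY : (⋃ s ∈ S, openConn s b : Set (BondConfig (Fin n))) = Set.univ := by
    refine Set.eq_univ_of_forall fun ω => ?_
    simp only [Set.mem_iUnion, exists_prop]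
    exact ⟨b, hbS, (SimpleGraph.Reachable.refl b : (openGraph ω).Reachable b b)⟩
  rw [hY, probReal_univ, Set.inter_univ]
  have h1 : μ.real ((openConn a₀ b)ᶜ ∩ (⋃ s ∈ S, openConn a₀ s)) ≤ μ.real (openConn a₀ b)ᶜ :=
    measureReal_mono Set.inter_subset_left (measure_ne_top _ _)
  have h2 : μ.real (openConn a₀ b) + μ.real (openConn a₀ b)ᶜ = 1 :=
    probReal_add_probReal_compl MeasurableSet.of_discrete
  have h3 : (0 : ℝ) ≤ ∑ W ∈ (Finset.univ : Finset (Finset (Fin n))).filter (fun W => Disjoint W A),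
      μ.real {ω : BondConfig (Fin n) | ∀ z : Fin n, (z ∈ W ↔ ω ∈ ⋃ s ∈ S, openConn s z)}
        * μ.real (openConnIn ((W : Set (Fin n))ᶜ) (sel W) b) :=
    Finset.sum_nonneg fun _ _ => mul_nonneg measureReal_nonneg measureReal_nonneg
  linarith

/-- **The block kernel at `A.card ≤ 4` reduces to its bad core.**  For `b, a₀ ∈ A`, `A.card ≤ 4`, `a₀` a minimiser of
`μ(· ↔ b)` over `A`, any block `S ≠ ∅` and any selection `sel W ∈ A`, the block-goodness inequality `BG(S)` holds provided
it holds in the bad core (`A.card = 4`, `a₀ ≠ b`, blocks disjoint from `A` all of whose vertices are strictly less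
reliable than `a₀`).  See the module docstring for the case list.
[cite: KozmaNitzan2024, §3.2 (Definition p. 12, Lemma 5 p. 13), Lemma 3 (pp. 6–7)] -/
theorem blockGood_cardLeFour_of_badCore (u : Sym2 (Fin n) → unitInterval) (A S : Finset (Fin n)) (b a₀ : Fin n)
    (sel : Finset (Fin n) → Fin n) (hbA : b ∈ A) (ha₀ : a₀ ∈ A) (hA4 : A.card ≤ 4)
    (hS : S.Nonempty) (hsel : ∀ W, sel W ∈ A)
    (hmin : ∀ a ∈ A, (prodBernoulli u).real (openConn a₀ b) ≤ (prodBernoulli u).real (openConn a b))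
    (hcore : A.card = 4 → a₀ ≠ b → ∀ S' : Finset (Fin n), S'.Nonempty → Disjoint S' A →
      (∀ v ∈ S', (prodBernoulli u).real (openConn v b) < (prodBernoulli u).real (openConn a₀ b)) →
      (prodBernoulli u).real (openConn a₀ b)
          + (prodBernoulli u).real
              ((openConn a₀ b)ᶜ ∩ (⋃ s ∈ S', openConn a₀ s) ∩ (⋃ s ∈ S', openConn s b))
        ≤ (prodBernoulli u).real (⋃ s ∈ S', openConn s b)
          + ∑ W ∈ (Finset.univ : Finset (Finset (Fin n))).filter (fun W => Disjoint W A),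
              (prodBernoulli u).real {ω : BondConfig (Fin n) | ∀ z : Fin n, (z ∈ W ↔ ω ∈ ⋃ s ∈ S', openConn s z)}
                * (prodBernoulli u).real (openConnIn ((W : Set (Fin n))ᶜ) (sel W) b)) :
    (prodBernoulli u).real (openConn a₀ b)
        + (prodBernoulli u).real
            ((openConn a₀ b)ᶜ ∩ (⋃ s ∈ S, openConn a₀ s) ∩ (⋃ s ∈ S, openConn s b))
      ≤ (prodBernoulli u).real (⋃ s ∈ S, openConn s b)
        + ∑ W ∈ (Finset.univ : Finset (Finset (Fin n))).filter (fun W => Disjoint W A),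
            (prodBernoulli u).real {ω : BondConfig (Fin n) | ∀ z : Fin n, (z ∈ W ↔ ω ∈ ⋃ s ∈ S, openConn s z)}
              * (prodBernoulli u).real (openConnIn ((W : Set (Fin n))ᶜ) (sel W) b) := by
  by_cases h3 : A.card ≤ 3
  · exact blockGood_cardLeThree u A S b a₀ sel hbA ha₀ h3 hS hsel hmin
  have h4 : A.card = 4 := by omega
  by_cases hab : a₀ = b
  · -- the designated relay is the target
    subst hab
    have hbb : (openConn a₀ a₀ : Set (BondConfig (Fin n))) = Set.univ :=
      Set.eq_univ_of_forall fun ω => (SimpleGraph.Reachable.refl a₀ : (openGraph ω).Reachable a₀ a₀)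
    have h0 : (prodBernoulli u).real ((openConn a₀ a₀)ᶜ ∩ (⋃ s ∈ S, openConn a₀ s) ∩ (⋃ s ∈ S, openConn s a₀)) = 0 := by
      rw [hbb, Set.compl_univ, Set.empty_inter, Set.empty_inter, measureReal_empty]
    rw [h0, add_zero, hbb, probReal_univ]
    exact blockGood_of_target_min u A S a₀ sel hS hsel hmin
  by_cases hbS : b ∈ S
  · exact blockGood_of_target_mem_block u A S b a₀ sel hbS
  by_cases hgood : ∃ v ∈ S, (prodBernoulli u).real (openConn a₀ b) ≤ (prodBernoulli u).real (openConn v b)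
  · -- a block with a reliable vertex: Kozma–Nitzan's Lemma 5 leaf
    obtain ⟨v, hv, hle⟩ := hgood
    exact blockGood_leaf_lemma5 u A S b a₀ v sel hv hbS hle
  · -- the bad core: every vertex of `S` is strictly less reliable than `a₀`, so `S` misses `A`
    push Not at hgood
    have hdisj : Disjoint S A := by
      rw [Finset.disjoint_left]
      intro v hvS hvA
      exact absurd (hmin v hvA) (not_le.2 (hgood v hvS))
    exact hcore h4 hab S hS hdisj hgood

end BlockGoodCardFourReduction

open Literature.Probability.LatticeModels Literature.Probability.Percolation in
/-- **TTRL variant V1352 of `stmt-CriticalPhenomena-4576` from its bad core.**  The registered variant (the block kernel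
`stub_blockGoodCardLeThree_sp` at `A.card ≤ 4`, verbatim) follows from the BAD CORE stated as a closed formula: the same
inequality for `A.card = 4`, `a₀ ≠ b`, a block `S ≠ ∅` disjoint from `A` all of whose vertices are strictly less reliable
than the minimiser `a₀` (no drift hypothesis).  With `S = {o}` the core is Kozma–Nitzan goodness for three relays and a bad
observer (Question 7 at `|A ∖ b| = 3`). [cite: KozmaNitzan2024, §3.2 (Definition p. 12), Question 7 (p. 36)] -/
theorem blockGood_cardLeFour_var1352_of_badCore
    (hcore : ∀ (n : ℕ) (u : Sym2 (Fin n) → unitInterval) (A S : Finset (Fin n)) (b a₀ : Fin n)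
      (sel : Finset (Fin n) → Fin n), b ∈ A → a₀ ∈ A → a₀ ≠ b → A.card = 4 → S.Nonempty → Disjoint S A →
      (∀ W, sel W ∈ A) →
      (∀ a ∈ A, (prodBernoulli u).real (openConn a₀ b) ≤ (prodBernoulli u).real (openConn a b)) →
      (∀ v ∈ S, (prodBernoulli u).real (openConn v b) < (prodBernoulli u).real (openConn a₀ b)) →
      (prodBernoulli u).real (openConn a₀ b)
          + (prodBernoulli u).real ((openConn a₀ b)ᶜ ∩ (⋃ s ∈ S, openConn a₀ s) ∩ (⋃ s ∈ S, openConn s b))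
        ≤ (prodBernoulli u).real (⋃ s ∈ S, openConn s b)
          + ∑ W ∈ (Finset.univ : Finset (Finset (Fin n))).filter (fun W => Disjoint W A),
              (prodBernoulli u).real {ω : BondConfig (Fin n) | ∀ z : Fin n, (z ∈ W ↔ ω ∈ ⋃ s ∈ S, openConn s z)}
                * (prodBernoulli u).real (openConnIn ((W : Set (Fin n))ᶜ) (sel W) b)) :
    ∀ (n : ℕ) (u : Sym2 (Fin n) → unitInterval) (A S : Finset (Fin n)) (b a₀ : Fin n) (sel : Finset (Fin n) → Fin n),
      b ∈ A → a₀ ∈ A → A.card ≤ 4 → S.Nonempty → (∀ W, sel W ∈ A) →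
      (∀ a ∈ A, (prodBernoulli u).real (openConn a₀ b) ≤ (prodBernoulli u).real (openConn a b)) →
      (prodBernoulli u).real (openConn a₀ b)
          + (prodBernoulli u).real ((openConn a₀ b)ᶜ ∩ (⋃ s ∈ S, openConn a₀ s) ∩ (⋃ s ∈ S, openConn s b))
        ≤ (prodBernoulli u).real (⋃ s ∈ S, openConn s b)
          + ∑ W ∈ (Finset.univ : Finset (Finset (Fin n))).filter (fun W => Disjoint W A),
              (prodBernoulli u).real {ω : BondConfig (Fin n) | ∀ z : Fin n, (z ∈ W ↔ ω ∈ ⋃ s ∈ S, openConn s z)}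
                * (prodBernoulli u).real (openConnIn ((W : Set (Fin n))ᶜ) (sel W) b) :=
  fun _ u A S b a₀ sel hbA ha₀ hA4 hS hsel hmin =>
    blockGood_cardLeFour_of_badCore u A S b a₀ sel hbA ha₀ hA4 hS hsel hmin
      fun h4 hab S' hS' hdisj hbad => hcore _ u A S' b a₀ sel hbA ha₀ hab h4 hS' hdisj hsel hmin hbad

open Literature.Probability.LatticeModels Literature.Probability.Percolation in
/-- Registered helper stub `stub_blockGoodCardLeFourOfBadCore_v1352` (TTRL deep seat v1352): **the block kernel at
`A.card ≤ 4` (variant V1352 verbatim) from its bad core** (= `blockGood_cardLeFour_var1352_of_badCore`).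
[cite: KozmaNitzan2024, §3.2 (Definition p. 12, Lemma 5 p. 13), Question 7 (p. 36)] -/
theorem stub_blockGoodCardLeFourOfBadCore_v1352 : (∀ (n : ℕ) (u : Sym2 (Fin n) → unitInterval) (A S : Finset (Fin n)) (b a₀ : Fin n) (sel : Finset (Fin n) → Fin n), b ∈ A → a₀ ∈ A → a₀ ≠ b → A.card = 4 → S.Nonempty → Disjoint S A → (∀ W, sel W ∈ A) → (∀ a ∈ A, (prodBernoulli u).real (openConn a₀ b) ≤ (prodBernoulli u).real (openConn a b)) → (∀ v ∈ S, (prodBernoulli u).real (openConn v b) < (prodBernoulli u).real (openConn a₀ b)) → (prodBernoulli u).real (openConn a₀ b) + (prodBernoulli u).real ((openConn a₀ b)ᶜ ∩ (⋃ s ∈ S, openConn a₀ s) ∩ (⋃ s ∈ S, openConn s b)) ≤ (prodBernoulli u).real (⋃ s ∈ S, openConn s b) + ∑ W ∈ (Finset.univ : Finset (Finset (Fin n))).filter (fun W => Disjoint W A), (prodBernoulli u).real {ω : BondConfig (Fin n) | ∀ z : Fin n, (z ∈ W ↔ ω ∈ ⋃ s ∈ S, openConn s z)} * (prodBernoulli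 u).real (openConnIn ((W : Set (Fin n))ᶜ) (sel W) b)) → ∀ (n : ℕ) (u : Sym2 (Fin n) → unitInterval) (A S : Finset (Fin n)) (b a₀ : Fin n) (sel : Finset (Fin n) → Fin n), b ∈ A → a₀ ∈ A → A.card ≤ 4 → S.Nonempty → (∀ W, sel W ∈ A) → (∀ a ∈ A, (prodBernoulli u).real (openConn a₀ b) ≤ (prodBernoulli u).real (openConn a b)) → (prodBernoulli u).real (openConn a₀ b) + (prodBernoulli u).real ((openConn a₀ b)ᶜ ∩ (⋃ s ∈ S, openConn a₀ s) ∩ (⋃ s ∈ S, openConn s b)) ≤ (prodBernoulli u).real (⋃ s ∈ S, openConn s b) + ∑ W ∈ (Finset.univ : Finset (Finset (Fin n))).filter (fun W => Disjoint W A), (prodBernoulli u).real {ω : BondConfig (Fin n) | ∀ z : Fin n, (z ∈ W ↔ ω ∈ ⋃ s ∈ S, openConn s z)} * (prodBernoulli u).real (openConnIn ((W : Set (Fin n))ᶜ) (sel W) b) :=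
  fun hcore => blockGood_cardLeFour_var1352_of_badCore hcore

end

end Summit.CriticalPhenomena.PercolationContinuityZ3.Theorems
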